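import Summits.NavierStokesRegularity.NavierStokesRegularity.Theses.ForcedAmplifier
import Literature.Analysis.FluidPDE.TorusClassicalNSForcedRestart

/-!
# `ForcedAmplifier.ViscosityNormalisation` HOLDS (route `ForcedAmplifier`, aside, decomp-ns node N31)

Route `Summits/NavierStokesRegularity/NavierStokesRegularity/Theses/ForcedAmplifier.lean` (negative
board, `closes_target` = the erratum leaf D♯).  The aside `ViscosityNormalisation`
(stmt-NavierStokesRegularity-28107) says that the residual crux `AMP` — unbounded `H¹` amplification by
smooth forced 1-periodic episodes of bounded `H¹` data size and bounded horizon, AT EVERY viscosity —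
follows from its unit-viscosity instance: at fixed period the viscosity is a time unit.  The parabolic
rescaling `(u, p, f)(t, x) ↦ (ν u(νt, x), ν² p(νt, x), ν² f(νt, x))` maps a classical episode on `[0, T]`
at viscosity `1` to one on `[0, T/ν]` at viscosity `ν` (tree:
`Torus.IsClassicalNSSolutionOn.rescale_translate`); `‖·‖²_{H¹}` of the datum scales by `ν²`, of the
force by `ν⁴`, horizons by `ν⁻¹`, peaks by `ν²`.  Here `‖v‖²_{H¹} := 2·Torus.kineticEnergy v +
Torus.gradNormSq v` is written out (the route items are def-free inlinings of the lens vocabulary).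

Port of the lens-4 g25 proof `ForcedAmplifierBridge.viscosityNormalisation_holds` (sha256 `c174d19f…`,
critic CLEARED (KERNEL) rows 251/252) onto the route declaration.
[cite: Tao2013Localisation,
Remark 1.11; RobinsonRodrigoSadowskiCUP2016, Introduction (13)]
-/

set_option linter.dupNamespace false

noncomputable section

open Set Function Filter
open scoped ContDiff Topology
open Literature.Analysis.FunctionSpaces Literature.Analysis.FluidPDE

namespace Summit.NavierStokesRegularity.NavierStokesRegularity.Theorems.ForcedAmplifierViscosityNormalisation

/-- Local notation: the flat unit 3-torus. -/
local notation "T3" => UnitAddTorus (Fin 3)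
/-- Local notation: Euclidean 3-space. -/
local notation "R3" => EuclideanSpace ℝ (Fin 3)

/-- `‖c w‖²_{H¹} = c² ‖w‖²_{H¹}` for smooth `w`, with `‖v‖²_{H¹} = 2·kineticEnergy v + gradNormSq v`.
[folklore] -/
theorem h1Sq_const_smul {w : T3 → R3} (hw : Torus.IsSmooth w) (c : ℝ) :
    2 * Torus.kineticEnergy (fun x => c • w x) + Torus.gradNormSq (fun x => c • w x) =
      c ^ 2 * (2 * Torus.kineticEnergy w + Torus.gradNormSq w) := by
  have hk : Torus.kineticEnergy (fun x => c • w x) = c ^ 2 * Torus.kineticEnergy w := by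
    simp only [Torus.kineticEnergy, norm_smul, mul_pow, Real.norm_eq_abs, sq_abs,
      MeasureTheory.integral_const_mul]
    ring
  have hg : Torus.gradNormSq (fun x => c • w x) = c ^ 2 * Torus.gradNormSq w := by
    have hcw : (fun x => c • w x) = c • w := rfl
    rw [hcw]
    unfold Torus.gradNormSq
    rw [← MeasureTheory.integral_const_mul]
    refine MeasureTheory.integral_congr_ae (MeasureTheory.ae_of_all _ fun x => ?_)
    dsimp only
    rw [Finset.mul_sum]
    refine Finset.sum_congr rfl fun i _ => ?_
    rw [Torus.partialDeriv_const_smul (hw.isContDiff (by simp)) c i, Pi.smul_apply,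
      norm_smul, mul_pow, Real.norm_eq_abs, sq_abs]
  rw [hk, hg]
  ring

/-- **`ViscosityNormalisation` HOLDS** (aside stmt-NavierStokesRegularity-28107 of route
`ForcedAmplifier`): `Amplification 1 → Amplification ν` for every `ν > 0`, by the parabolic rescaling
from `[0, T]` at viscosity `1` to `[0, T/ν]` at viscosity `ν`.
[cite: Tao2013Localisation, Remark 1.11; RobinsonRodrigoSadowskiCUP2016, Introduction (13)] -/
theorem viscosityNormalisation_holds : Theses.ForcedAmplifier.ViscosityNormalisation := by
  rintro ⟨A, T₀, hM⟩ ν hν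
  refine ⟨max (ν ^ 2 * A) ((ν ^ 2) ^ 2 * A), T₀ / ν, fun M => ?_⟩
  obtain ⟨T, f, u, p, ⟨hT, hcl, hf⟩, hTT₀, hu0, hfA, t, ht, hMt⟩ := hM (M / ν ^ 2)
  have hν2 : 0 < ν ^ 2 := by positivity
  -- the rescaled episode at viscosity `ν` on `[0, T/ν]`
  have hres := hcl.rescale_translate (t₀ := (0 : ℝ)) hν hT
  simp only [sub_zero, zero_add, mul_one] at hres
  have hφ : ContDiff ℝ ∞ (fun z : ℝ × R3 => ((ν * z.1, z.2) : ℝ × R3)) :=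
    (contDiff_const.mul contDiff_fst).prodMk contDiff_snd
  have hmaps : ∀ s ∈ Icc (0 : ℝ) (T / ν), ν * s ∈ Icc (0 : ℝ) T := fun s hs =>
    ⟨mul_nonneg hν.le hs.1, by
      rw [← mul_div_cancel₀ T hν.ne']
      exact mul_le_mul_of_nonneg_left hs.2 hν.le⟩
  have hφmaps : MapsTo (fun z : ℝ × R3 => ((ν * z.1, z.2) : ℝ × R3)) (Icc 0 (T / ν) ×ˢ univ)
      (Icc 0 T ×ˢ univ) := fun z hz =>
    mk_mem_prod (hmaps z.1 (mem_prod.1 hz).1) (mem_univ _)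
  have hf₁ : Torus.IsSmoothSpaceTimeOn (Icc 0 (T / ν)) (fun s x => f (ν * s) x) :=
    hf.comp hφ.contDiffOn hφmaps
  have hf' : Torus.IsSmoothSpaceTimeOn (Icc 0 (T / ν)) (fun s x => ν ^ 2 • f (ν * s) x) :=
    hf₁.const_smul (ν ^ 2)
  refine ⟨T / ν, fun s x => ν ^ 2 • f (ν * s) x, fun s x => ν • u (ν * s) x,
    fun s x => ν ^ 2 * p (ν * s) x, ⟨div_pos hT hν, hres, hf'⟩, ?_, ?_, ?_, ?_⟩
  · exact div_le_div_of_nonneg_right hTT₀ hν.le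
  · -- the datum: `‖ν u(0)‖²_{H¹} = ν² ‖u(0)‖²_{H¹} ≤ ν² A`
    show 2 * Torus.kineticEnergy (fun x => ν • u (ν * 0) x) +
        Torus.gradNormSq (fun x => ν • u (ν * 0) x) ≤ _
    simp only [mul_zero]
    rw [h1Sq_const_smul (hcl.smooth_velocity.isSmooth_slice ⟨le_rfl, hT.le⟩) ν]
    exact le_trans (mul_le_mul_of_nonneg_left hu0 hν2.le) (le_max_left _ _)
  · -- the force: `‖ν² f(νs)‖²_{H¹} = ν⁴ ‖f(νs)‖²_{H¹} ≤ ν⁴ A`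
    intro s hs
    have hs' := hmaps s hs
    show 2 * Torus.kineticEnergy (fun x => ν ^ 2 • f (ν * s) x) +
        Torus.gradNormSq (fun x => ν ^ 2 • f (ν * s) x) ≤ _
    rw [h1Sq_const_smul (hf.isSmooth_slice hs') (ν ^ 2)]
    exact le_trans (mul_le_mul_of_nonneg_left (hfA _ hs') (by positivity)) (le_max_right _ _)
  · -- the peak: at `s = t/ν`, `‖ν u(t)‖²_{H¹} = ν² ‖u(t)‖²_{H¹} > ν² · M/ν² = M`
    refine ⟨t / ν, ⟨div_nonneg ht.1 hν.le, div_le_div_of_nonneg_right ht.2 hν.le⟩, ?_⟩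
    show M < 2 * Torus.kineticEnergy (fun x => ν • u (ν * (t / ν)) x) +
        Torus.gradNormSq (fun x => ν • u (ν * (t / ν)) x)
    rw [mul_div_cancel₀ t hν.ne', h1Sq_const_smul (hcl.smooth_velocity.isSmooth_slice ht) ν, mul_comm]
    exact (div_lt_iff₀ hν2).1 hMt

end Summit.NavierStokesRegularity.NavierStokesRegularity.Theorems.ForcedAmplifierViscosityNormalisation

end
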